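import Summits.BirchSwinnertonDyer.BirchSwinnertonDyer.Theorems.PrintCFramBottomClassIndexLawFiveLeSelmerCountEvenRegular
import Summits.BirchSwinnertonDyer.BirchSwinnertonDyer.Theorems.PrintCFramBottomClassIndexLawFiveLeSelmerCountCaseSPRank
import HarnessLib

/-!
# Route `PrintCFram`, crux C2 `BottomClassIndexLawFiveLe` (stmt-BirchSwinnertonDyer-20372), line
# `eisenstein-resource-bdp-line` (registry v19, stub B1 `stub_bsdp_of_classFactor`): **THE SELMER COUNT ON THE CLASS, EVEN-REGULAR MEMBERS,
# p-RANK FORM, MAZUR–WILES-FREE** — «EVEN-REGULAR ∧ every abelian realisation of `ψ` has `#(e_χ(ℤ_p ⊗ Cl))[p] ≤ N` ⟹ `#Sel_p(W/ℚ) ≤ p·N`»;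
# at `N = p` (CYCLIC `ψ`-components of any order) the parity split applies: `Ш(W)[p] = 0`, `BSD_p(W) ⟺ p ∤ #Ш_an(W)`
# (cell `bsd-print-cfram`, width seat `bsd-line-cfram-p1-w4` g10; helper `--supports` 20372; 0 defs, 0 facts, 0 sorry;
# the `BSD_p` corollaries are CONDITIONAL on Cassels–Tate (`hCT`) and GZK, as in w2 g10's file)

HONEST FRAMING. Nothing about BSD is proved unconditionally here and no stub is closed; B1 is NOT proved. This is the `p`-RANK form of
w2 g10's `SelmerCount.natCard_selmerGroup_le_sq_of_evenRegular` (p679491), exactly as `…SelmerCountCaseSPRank` (p680526) is the `p`-rank form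
of w2 g9's CASE S count: the hypotheses «`‖B_{1,ψ⁻¹}‖_p = p⁻¹`» and Mazur–Wiles Thm 2 are REPLACED by

  `hrank N`: every number field `L` ABELIAN over `ℚ` with `p ∤ [L:ℚ]` and every `χ : Gal(L/ℚ) →* ℤ_pˣ` realising `ψ`
  (`χ(τ̄) = ψ(χ_f τ)` in `ℚ_p`) has `#(e_χ(ℤ_p ⊗ Cl(𝓞 L)))[p] ≤ N`,

and the conclusion is `#Sel_p(W/ℚ) ≤ p·N` (both-strict dévissage count `dim Sel_p ≤ 1 + u_str(θ_e) + u_str(ψ)` with `u_str(θ_e) = 0` by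
EVEN-REGULARITY and `#R_str(ψ-line) ≤ N` by the MW-free class side `SelmerCountClassSide.natCard_strict_le_of_chiTorsion_le`). At `N = p`
(«the `ψ`-part of the class group is CYCLIC», of any order `p^v`; `HerbrandCountPRank.natCard_chiTorsion_le_of_isAddCyclic`) the bound is `p²`
and w2 g8 / w3 g8's parity-split corollaries apply verbatim; Mazur–Wiles at `‖B_{1,ψ⁻¹}‖_p = p^{−v}` gives `hrank (p^v)`
(`SelmerCount.chiTorsion_le_pow_of_mazurWiles`), so p679491 is the `v = 1` instance. The proof is w2 g10's, with the two Mazur–Wiles calls replaced.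

* **`natCard_selmerGroup_le_prime_mul_of_evenRegular_of_chiTorsion_le`** — class member, odd datum + `hss`, EVEN-REGULAR, `hrank N` ⊢ `#Sel_p(W/ℚ) ≤ p·N`.
* `natCard_selmerGroup_le_sq_of_evenRegular_of_chiTorsion_le` (`N = p` ⊢ `≤ p²`), `sha_noPTorsion_of_evenRegular_of_chiTorsion_le`,
  `bsdp_iff_shaAnUnit_of_evenRegular_of_chiTorsion_le` (mod `hCT`, `hGZK`, `r_an = 1`).

NET with p680526: MAZUR–WILES-FREE, a B1 member whose `ψ`-class-group-part is CYCLIC lies on the small-Selmer branch (`Ш(W)[p] = 0`,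
`BSD_p ⟺ p ∤ #Ш_an(W)` ⟺ Heegner `p`-primitivity, mod CT + GZK) as soon as it is in CASE S **or** EVEN-REGULAR — for every `v_p(B_{1,ψ⁻¹})`.
THEOREMS ONLY; no definition, no named fact, no `sorry`. BSD is not proved by any of this; no summit statement is proved by this seat.
References: [SilvermanAEC2009] X.§4; [Washington1997] §6.3, §10.2; [BhargavaSkinner2014] proof of Lemma 16; [Cassels1962ArithmeticIV];
[GreenbergLNM1716] §3; seat notes w2g8 §4, w2g9 §2, w7g3 §2; HOME/HANDOFF §line-cfram-p1-w7 g3 addendum (ii).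
-/

set_option autoImplicit false
-- `…BirchSwinnertonDyer.BirchSwinnertonDyer.Theorems…` is the problem's mandated namespace (D-0017).
set_option linter.dupNamespace false

noncomputable section

open scoped Classical Pointwise

namespace Summit.BirchSwinnertonDyer.BirchSwinnertonDyer.Theorems.PrintCFram.SelmerCount

open NumberField IsDedekindDomain Field WeierstrassCurve DirichletCharacter
open Literature.NumberTheory.NumberFields Literature.NumberTheory.EllipticCurves Literature.NumberTheory.GaloisRepresentations
  Literature.NumberTheory.EllipticCurves.Rank1Residual Literature.NumberTheory.EllipticCurves.KrizLi2019
  Literature.NumberTheory.EllipticCurves.GreenbergSelmer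
open Summit.BirchSwinnertonDyer.Rank1Residual Summit.BirchSwinnertonDyer.Rank1Residual.X2.ResidualDevissageModules
open Summit.BirchSwinnertonDyer.BirchSwinnertonDyer.Theorems.PrintCFram.HerbrandSelmerToHom
open Summit.BirchSwinnertonDyer.BirchSwinnertonDyer.Theorems.PrintCFram.LevelDictionaryAlpha

variable {p : ℕ} [hp : Fact p.Prime]
variable (W : WeierstrassCurve ℚ) [W.IsElliptic] [W.IsGloballyMinimal]

/-! ## §1 The both-strict count under EVEN-REGULARITY, `p`-rank form -/

/-- **THE SELMER COUNT ON THE CLASS, EVEN-REGULAR MEMBERS, p-RANK FORM (MAZUR–WILES-FREE): `#Sel_p(W/ℚ) ≤ p·N`.** `W/ℚ` globally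
minimal with CM, `p ≥ 5` ramified in the CM field, `(f, ψ, ω)` a Kriz–Li character datum with `ψ` ODD, `ω` Teichmüller and the trace form
`hss`; `v` the place above `p`; EVEN-REGULAR as in p679491 (if a complex conjugation acts trivially on a stable line `Φ ≤ W[p]` of order `p`
then `#H¹(Γ_ℚ, Φ; ∅) ≤ 1`, if by `−1` then `#H¹(Γ_ℚ, W[p]/Φ; ∅) ≤ 1`); and `hrank`: every ABELIAN realisation `(L, χ)` of `ψ` with
`p ∤ [L:ℚ]` has `#(e_χ(ℤ_p ⊗ Cl(𝓞 L)))[p] ≤ N`. THEN `#Sel_p(W/ℚ) ≤ p·N`. PROOF (w2 g10's): rational line data, the both-strict count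
`#Sel_p ≤ p·#R_str(Φ.Quot)·#R_str(Φ.Sub)`, `R_str ≤ H¹(·;∅)`; the EVEN line has `#R_str ≤ 1`, the ODD line realises `ψ`
(w5 g3's `LevelDictionaryBeta.apply_modNCyclotomicCharacter_eq_teich_sub/_quot`) and has `#R_str ≤ N` by
`SelmerCountClassSide.natCard_strict_le_of_chiTorsion_le`. [cite: SilvermanAEC2009, X.§4 (Cor. 4.4, Ex. 4.8)]
[cite: BhargavaSkinner2014, proof of Lemma 16] [cite: Washington1997, §6.3] [cite: GreenbergLNM1716, §3 (PDF p. 86)] -/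
theorem natCard_selmerGroup_le_prime_mul_of_evenRegular_of_chiTorsion_le
    (hCM : W.HasCM) (hram : CMRamified W p) (h5 : 5 ≤ p)
    {f : ℕ} [NeZero f] (ψ : DirichletCharacter ℚ_[p] f) (ω : DirichletCharacter ℚ_[p] p)
    (hψ : ψ.Odd) (hω : IsTeichmullerCharacter ω)
    (hss : ∀ ℓ : ℕ, ℓ.Prime → ¬ (ℓ ∣ p * W.conductorNorm ℤ) →
      ‖((W.LFunction ℓ : ℤ) : ℚ_[p]) - (ψ (ℓ : ZMod f) + ψ⁻¹ (ℓ : ZMod f) * ω (ℓ : ZMod p))‖ < 1)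
    {N : ℕ}
    (hrank : ∀ (L : Type) [Field L] [NumberField L] [IsAbelianGalois ℚ L], ¬ p ∣ Module.finrank ℚ L →
      ∀ χ : (L ≃ₐ[ℚ] L) →* ℤ_[p]ˣ,
        (∀ τ : absoluteGaloisGroup ℚ, (((χ (absGaloisQuot ℚ L τ) : ℤ_[p]ˣ) : ℤ_[p]) : ℚ_[p]) =
          ψ ((modNCyclotomicCharacter ℚ f τ : (ZMod f)ˣ) : ZMod f)) →
        Nat.card {y : ↥(classGroupChiComponent ℚ L p (fun g => ((χ g : ℤ_[p]ˣ) : ℤ_[p]))) // p • y = 0} ≤ N)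
    {v : HeightOneSpectrum (𝓞 ℚ)} (hpv : ((p : ℕ) : 𝓞 ℚ) ∈ v.asIdeal)
    (hE : ∀ (Φ : StableSubgroup (absoluteGaloisGroup ℚ) (geomTorsion W (p : ℤ))), Nat.card Φ.Sub = p →
      ∀ c : absoluteGaloisGroup ℚ, IsComplexConjugation (Rat.castHom ℝ) c →
        ((∀ x : Φ.Sub, c • x = x) →
          Nat.card ↥(h1Unramified Φ.Sub (∅ : Set (HeightOneSpectrum (𝓞 ℚ)))) ≤ 1) ∧
        ((∀ x : Φ.Sub, c • x = -x) →
          Nat.card ↥(h1Unramified Φ.Quot (∅ : Set (HeightOneSpectrum (𝓞 ℚ)))) ≤ 1)) :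
    Nat.card (selmerGroup W (p : ℤ)) ≤ p * N := by
  have hpr : p.Prime := hp.out
  have hp2 : p ≠ 2 := by omega
  haveI hpne : NeZero p := ⟨hpr.ne_zero⟩
  haveI : Fact (1 < p) := ⟨hpr.one_lt⟩
  have hωodd : ω.Odd := KrizLiBinders.teichmuller_apply_neg_one hp2 hω
  -- the rational line, its characters and avatars
  obtain ⟨Φ, θS, θQ, m, hmz, b, ψ₁, hfM, hmM, hpM, hcard, hθS, hkerS, hθQ, hkerQ, hprod, hSb, hQb, hψ₁, e⟩ :=
    exists_rationalLineData_of_hss p W hCM h5 hram ψ ω hω hss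
  have hcardQ : Nat.card Φ.Quot = p := HerbrandLineRestriction.natCard_quot_eq_of_card_sub W Φ hcard
  have hcontS : ∀ x : Φ.Sub, Continuous fun g : absoluteGaloisGroup ℚ ↦ g • x :=
    Φ.continuous_smul_sub (LevelDictionary.continuous_smul_geomTorsion W (p : ℤ))
  have hcontQ : ∀ y : Φ.Quot, Continuous fun g : absoluteGaloisGroup ℚ ↦ g • y :=
    Φ.continuous_smul_quot (LevelDictionary.continuous_smul_geomTorsion W (p : ℤ))
  have hpS : ∀ x : Φ.Sub, (p : ℤ) • x = 0 := fun x ↦ by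
    rw [natCast_zsmul]; exact HerbrandLineRestriction.prime_nsmul_eq_zero_of_card_prime hcard x
  -- non-trivial action and the decomposition witnesses at `p`
  obtain ⟨𝔓₀, h𝔓₀⟩ := v.primesAbove_nonempty
  obtain ⟨g₀, -, -, c₀, hc₀, hg₀⟩ := BorelTorsion.exists_sq_mem_inertia_homothety (W := W) p hCM h5 hram hpv h𝔓₀
  have hntS : ∃ (g : absoluteGaloisGroup ℚ) (x : Φ.Sub), g • x ≠ x := by
    haveI : Finite Φ.Sub := Nat.finite_of_card_ne_zero (by rw [hcard]; exact hpr.ne_zero)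
    haveI : Nontrivial Φ.Sub := Finite.one_lt_card_iff_nontrivial.mp (by rw [hcard]; exact hpr.one_lt)
    obtain ⟨x, hx⟩ := exists_ne (0 : Φ.Sub)
    exact ⟨g₀, x, HerbrandInertiaAtP.smul_ne_sub_of_homothety W Φ hcard hc₀ hg₀ hx⟩
  have hntQ : ∃ (g : absoluteGaloisGroup ℚ) (y : Φ.Quot), g • y ≠ y := by
    haveI : Finite Φ.Quot := Nat.finite_of_card_ne_zero (by rw [hcardQ]; exact hpr.ne_zero)
    haveI : Nontrivial Φ.Quot := Finite.one_lt_card_iff_nontrivial.mp (by rw [hcardQ]; exact hpr.one_lt)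
    obtain ⟨y, hy⟩ := exists_ne (0 : Φ.Quot)
    exact ⟨g₀, y, HerbrandInertiaAtP.smul_ne_quot_of_homothety W Φ hcard hc₀ hg₀ hy⟩
  -- a complex conjugation and the parities of the two characters
  obtain ⟨c, hc⟩ := exists_isComplexConjugation (Rat.castHom ℝ)
  have hmc : modNCyclotomicCharacter ℚ m c = -1 :=
    Units.ext (by rw [Units.val_neg, Units.val_one]; exact modNCyclotomicCharacter_of_isComplexConjugation hc)
  have hSc : θS c = b (-1) := by rw [hSb c, hmc]
  have hpar := BernoulliUnits.odd_iff_of_teichmuller_lift hp2 b hψ₁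
  -- the class-side local inputs: at `p` and at the bad places `≠ p`
  have htors : Nat.card (nsmulAddMonoidHom p :
      (W.baseChange (v.adicCompletion ℚ)).toAffine.Point →+ _).ker = 1 :=
    (W.natCard_ker_nsmul_adicCompletion_eq_one_iff hpv p).2
      (RamifiedSevenEllipticUnits.prime_nsmul_eq_zero_padic_of_hasCM_of_cmRamified W p hCM h5 hram)
  have hQD : ∀ q : Φ.Quot, (∀ g ∈ decomp v, g • q = q) → q = 0 := fun q hq ↦
    quot_eq_zero_of_forall_inertia_smul_eq_at_p W Φ hCM h5 hram hcard hpv (adicCompletionPrime_mem_primesAbove ℚ v) q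
      fun g hg ↦ hq g (by
        have h := Ideal.inertia_le_decompositionSubgroup (absoluteGaloisGroup ℚ) (adicCompletionPrime ℚ v) hg
        rw [decompositionSubgroup_adicCompletionPrime_eq_range] at h
        exact h)
  have hbad' : ∀ v' : HeightOneSpectrum (𝓞 ℚ), ¬ W.HasGoodReductionAt v' → ((p : ℕ) : 𝓞 ℚ) ∉ v'.asIdeal →
      ∀ P : (W.baseChange (v'.adicCompletion ℚ)).toAffine.Point, p • P = 0 → P = 0 :=
    fun v' hg hpv' ↦ forall_prime_nsmul_eq_zero_adicCompletion_of_bad (K := ℚ) W hCM hram h5 hpv' hg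
  have hQI' : ∀ v' : HeightOneSpectrum (𝓞 ℚ), ¬ W.HasGoodReductionAt v' → ((p : ℕ) : 𝓞 ℚ) ∉ v'.asIdeal →
      ∀ 𝔓 ∈ v'.primesAbove, ∀ q : Φ.Quot,
        (∀ g ∈ 𝔓.inertia (absoluteGaloisGroup ℚ), g • q = q) → q = 0 :=
    fun v' hg hpv' 𝔓 h𝔓 q hq ↦ quot_eq_zero_of_forall_inertia_smul_eq_of_bad (K := ℚ) W Φ hCM hram h5 hpv' hg h𝔓 q hq
  -- the both-strict count
  have hcount := natCard_selmerGroup_le_prime_mul_natCard_strict W hpv htors Φ hQD hbad' hQI'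
  -- `R_str ≤ H¹(·; ∅)` and finiteness
  haveI : Finite Φ.Sub := Nat.finite_of_card_ne_zero (by rw [hcard]; exact hpr.ne_zero)
  haveI : Finite Φ.Quot := Nat.finite_of_card_ne_zero (by rw [hcardQ]; exact hpr.ne_zero)
  haveI : Finite ↥(h1Unramified Φ.Sub (∅ : Set (HeightOneSpectrum (𝓞 ℚ)))) :=
    finite_h1Unramified_of_continuous Φ.Sub hcontS Set.finite_empty
  haveI : Finite ↥(h1Unramified Φ.Quot (∅ : Set (HeightOneSpectrum (𝓞 ℚ)))) :=
    finite_h1Unramified_of_continuous Φ.Quot hcontQ Set.finite_empty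
  have hleS : Nat.card ↥(h1Unramified Φ.Sub {v' : HeightOneSpectrum (𝓞 ℚ) | ((p : ℕ) : 𝓞 ℚ) ∈ v'.asIdeal} ⊓
        subgroupResKer Φ.Sub (decomp v)) ≤ Nat.card ↥(h1Unramified Φ.Sub (∅ : Set (HeightOneSpectrum (𝓞 ℚ)))) :=
    Nat.card_le_card_of_injective _ (AddSubgroup.inclusion_injective (inf_subgroupResKer_decomp_le_h1Unramified_empty Φ.Sub hpv))
  have hleQ : Nat.card ↥(h1Unramified Φ.Quot {v' : HeightOneSpectrum (𝓞 ℚ) | ((p : ℕ) : 𝓞 ℚ) ∈ v'.asIdeal} ⊓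
        subgroupResKer Φ.Quot (decomp v)) ≤ Nat.card ↥(h1Unramified Φ.Quot (∅ : Set (HeightOneSpectrum (𝓞 ℚ)))) :=
    Nat.card_le_card_of_injective _ (AddSubgroup.inclusion_injective (inf_subgroupResKer_decomp_le_h1Unramified_empty Φ.Quot hpv))
  rcases e with e | e
  · -- `ψ ~ ψ₁`: the SUB character `θS` is ODD and realises `ψ`, the QUOTIENT character is the EVEN one
    have hψ₁odd : ψ₁.Odd := by
      unfold DirichletCharacter.Odd
      rw [BernoulliUnits.apply_neg_one_eq_of_changeLevel_eq hmM ψ₁ e.symm, EisensteinPair.changeLevel_apply_neg_one]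
      exact hψ
    have hb1 : b (-1) = -1 := hpar.1.mp hψ₁odd
    have hθSc : θS c = -1 := by rw [hSc, hb1]
    have hcx : ∀ x : Φ.Sub, c • x = -x := by
      intro x
      rw [hθS c x, hθSc, Units.val_neg, Units.val_one, ZMod.neg_val', ZMod.val_one,
        Nat.mod_eq_of_lt (Nat.sub_lt hpr.pos Nat.one_pos), Nat.cast_sub hpr.one_lt.le, Nat.cast_one, sub_smul,
        one_smul, hpS, zero_sub]
    -- quotient (even): `≤ 1` by EVEN-REGULAR; sub (odd): `≤ N` by the MW-free strict count
    have hQ : Nat.card ↥(h1Unramified Φ.Quot {v' : HeightOneSpectrum (𝓞 ℚ) | ((p : ℕ) : 𝓞 ℚ) ∈ v'.asIdeal} ⊓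
        subgroupResKer Φ.Quot (decomp v)) ≤ 1 := hleQ.trans ((hE Φ hcard c hc).2 hcx)
    have havS : ∀ τ : absoluteGaloisGroup ℚ, ψ ((modNCyclotomicCharacter ℚ f τ : (ZMod f)ˣ) : ZMod f) =
        (((Kato2004.teichmullerChar p (θS τ) : ℤ_[p]ˣ) : ℤ_[p]) : ℚ_[p]) :=
      LevelDictionaryBeta.apply_modNCyclotomicCharacter_eq_teich_sub b hψ₁ θS hSb hfM hmM ψ e
    have hrankS : ∀ (L : Type) [Field L] [NumberField L] [IsAbelianGalois ℚ L], ¬ p ∣ Module.finrank ℚ L →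
        ∀ χ : (L ≃ₐ[ℚ] L) →* ℤ_[p]ˣ,
          (∀ τ : absoluteGaloisGroup ℚ, χ (absGaloisQuot ℚ L τ) = Kato2004.teichmullerChar p (θS τ)) →
          Nat.card {y : ↥(classGroupChiComponent ℚ L p (fun g => ((χ g : ℤ_[p]ˣ) : ℤ_[p]))) // p • y = 0} ≤ N :=
      fun L _ _ _ hpL χ hχ ↦ hrank L hpL χ fun τ ↦ by rw [hχ τ, havS τ]
    have hSu := SelmerCountClassSide.natCard_strict_le_of_chiTorsion_le hp2 hcard hcontS hntS θS hθS hkerS hrankS hpv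
    calc Nat.card (selmerGroup W (p : ℤ)) ≤ _ := hcount
      _ ≤ p * (1 * N) := Nat.mul_le_mul_left p (Nat.mul_le_mul hQ hSu)
      _ = p * N := by rw [one_mul]
  · -- `ψ ~ ψ₁⁻¹ω`: the SUB character `θS` is EVEN, the QUOTIENT character `θQ` is ODD and realises `ψ`
    have hL₁ : changeLevel hmM ψ₁ = changeLevel hfM ψ⁻¹ * changeLevel hpM ω := by
      rw [map_inv, e, map_inv, mul_inv, inv_inv, inv_mul_cancel_right]
    have hψ₁even : ψ₁.Even := by
      unfold DirichletCharacter.Even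
      rw [BernoulliUnits.apply_neg_one_eq_of_changeLevel_eq hmM ψ₁ hL₁, MulChar.mul_apply, map_inv,
        MulChar.inv_apply_eq_inv', EisensteinPair.changeLevel_apply_neg_one, EisensteinPair.changeLevel_apply_neg_one,
        hψ, hωodd, inv_neg, inv_one, neg_mul_neg, one_mul]
    have hb1 : b (-1) = 1 := hpar.2.mp hψ₁even
    have hθSc : θS c = 1 := by rw [hSc, hb1]
    have hcx : ∀ x : Φ.Sub, c • x = x := by
      intro x
      rw [hθS c x, hθSc, Units.val_one, ZMod.val_one, Nat.cast_one, one_smul]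
    -- sub (even): `≤ 1` by EVEN-REGULAR; quotient (odd): `≤ N` by the MW-free strict count
    have hSu : Nat.card ↥(h1Unramified Φ.Sub {v' : HeightOneSpectrum (𝓞 ℚ) | ((p : ℕ) : 𝓞 ℚ) ∈ v'.asIdeal} ⊓
        subgroupResKer Φ.Sub (decomp v)) ≤ 1 := hleS.trans ((hE Φ hcard c hc).1 hcx)
    have havQ : ∀ τ : absoluteGaloisGroup ℚ, ψ ((modNCyclotomicCharacter ℚ f τ : (ZMod f)ˣ) : ZMod f) =
        (((Kato2004.teichmullerChar p (θQ τ) : ℤ_[p]ˣ) : ℤ_[p]) : ℚ_[p]) :=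
      LevelDictionaryBeta.apply_modNCyclotomicCharacter_eq_teich_quot hp2 b hψ₁ hω θQ hQb hfM hmM hpM ψ e
    have hrankQ : ∀ (L : Type) [Field L] [NumberField L] [IsAbelianGalois ℚ L], ¬ p ∣ Module.finrank ℚ L →
        ∀ χ : (L ≃ₐ[ℚ] L) →* ℤ_[p]ˣ,
          (∀ τ : absoluteGaloisGroup ℚ, χ (absGaloisQuot ℚ L τ) = Kato2004.teichmullerChar p (θQ τ)) →
          Nat.card {y : ↥(classGroupChiComponent ℚ L p (fun g => ((χ g : ℤ_[p]ˣ) : ℤ_[p]))) // p • y = 0} ≤ N :=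
      fun L _ _ _ hpL χ hχ ↦ hrank L hpL χ fun τ ↦ by rw [hχ τ, havQ τ]
    have hQ := SelmerCountClassSide.natCard_strict_le_of_chiTorsion_le hp2 hcardQ hcontQ hntQ θQ hθQ hkerQ hrankQ hpv
    calc Nat.card (selmerGroup W (p : ℤ)) ≤ _ := hcount
      _ ≤ p * (N * 1) := Nat.mul_le_mul_left p (Nat.mul_le_mul hQ hSu)
      _ = p * N := by rw [mul_one]

/-! ## §2 At `N = p`: the parity-split corollaries (modulo Cassels–Tate and GZK) -/

/-- **`#Sel_p(W/ℚ) ≤ p²` on «EVEN-REGULAR ∧ cyclic `ψ`-components»** (`hrank p`), MW-free. [cite: SilvermanAEC2009, X.§4]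
[cite: Washington1997, §6.3] -/
theorem natCard_selmerGroup_le_sq_of_evenRegular_of_chiTorsion_le
    (hCM : W.HasCM) (hram : CMRamified W p) (h5 : 5 ≤ p)
    {f : ℕ} [NeZero f] (ψ : DirichletCharacter ℚ_[p] f) (ω : DirichletCharacter ℚ_[p] p)
    (hψ : ψ.Odd) (hω : IsTeichmullerCharacter ω)
    (hss : ∀ ℓ : ℕ, ℓ.Prime → ¬ (ℓ ∣ p * W.conductorNorm ℤ) →
      ‖((W.LFunction ℓ : ℤ) : ℚ_[p]) - (ψ (ℓ : ZMod f) + ψ⁻¹ (ℓ : ZMod f) * ω (ℓ : ZMod p))‖ < 1)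
    (hrank : ∀ (L : Type) [Field L] [NumberField L] [IsAbelianGalois ℚ L], ¬ p ∣ Module.finrank ℚ L →
      ∀ χ : (L ≃ₐ[ℚ] L) →* ℤ_[p]ˣ,
        (∀ τ : absoluteGaloisGroup ℚ, (((χ (absGaloisQuot ℚ L τ) : ℤ_[p]ˣ) : ℤ_[p]) : ℚ_[p]) =
          ψ ((modNCyclotomicCharacter ℚ f τ : (ZMod f)ˣ) : ZMod f)) →
        Nat.card {y : ↥(classGroupChiComponent ℚ L p (fun g => ((χ g : ℤ_[p]ˣ) : ℤ_[p]))) // p • y = 0} ≤ p)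
    {v : HeightOneSpectrum (𝓞 ℚ)} (hpv : ((p : ℕ) : 𝓞 ℚ) ∈ v.asIdeal)
    (hE : ∀ (Φ : StableSubgroup (absoluteGaloisGroup ℚ) (geomTorsion W (p : ℤ))), Nat.card Φ.Sub = p →
      ∀ c : absoluteGaloisGroup ℚ, IsComplexConjugation (Rat.castHom ℝ) c →
        ((∀ x : Φ.Sub, c • x = x) →
          Nat.card ↥(h1Unramified Φ.Sub (∅ : Set (HeightOneSpectrum (𝓞 ℚ)))) ≤ 1) ∧
        ((∀ x : Φ.Sub, c • x = -x) →
          Nat.card ↥(h1Unramified Φ.Quot (∅ : Set (HeightOneSpectrum (𝓞 ℚ)))) ≤ 1)) :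
    Nat.card (selmerGroup W (p : ℤ)) ≤ p ^ 2 := by
  rw [pow_two]
  exact natCard_selmerGroup_le_prime_mul_of_evenRegular_of_chiTorsion_le W hCM hram h5 ψ ω hψ hω hss hrank hpv hE

/-- **On «EVEN-REGULAR ∧ cyclic `ψ`-components», `Ш(W)[p] = 0`** (mod Cassels–Tate, GZK; `r_an = 1`) — for every `v_p(B_{1,ψ⁻¹})`
(`#Sel_p ≤ p²` + w3 g8's `ParitySplit.noPTorsion_of_natCard_selmerGroup_le_sq`). [cite: Cassels1962ArithmeticIV] [cite: Washington1997, §6.3] -/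
theorem sha_noPTorsion_of_evenRegular_of_chiTorsion_le
    (hCT : exists_casselsTate_pairing (K := ℚ)) (hGZK : rank_eq_analyticRank_of_analyticRank_le_one)
    (hCM : W.HasCM) (hram : CMRamified W p) (h5 : 5 ≤ p) (hr : W.analyticRank = 1)
    {f : ℕ} [NeZero f] (ψ : DirichletCharacter ℚ_[p] f) (ω : DirichletCharacter ℚ_[p] p)
    (hψ : ψ.Odd) (hω : IsTeichmullerCharacter ω)
    (hss : ∀ ℓ : ℕ, ℓ.Prime → ¬ (ℓ ∣ p * W.conductorNorm ℤ) →
      ‖((W.LFunction ℓ : ℤ) : ℚ_[p]) - (ψ (ℓ : ZMod f) + ψ⁻¹ (ℓ : ZMod f) * ω (ℓ : ZMod p))‖ < 1)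
    (hrank : ∀ (L : Type) [Field L] [NumberField L] [IsAbelianGalois ℚ L], ¬ p ∣ Module.finrank ℚ L →
      ∀ χ : (L ≃ₐ[ℚ] L) →* ℤ_[p]ˣ,
        (∀ τ : absoluteGaloisGroup ℚ, (((χ (absGaloisQuot ℚ L τ) : ℤ_[p]ˣ) : ℤ_[p]) : ℚ_[p]) =
          ψ ((modNCyclotomicCharacter ℚ f τ : (ZMod f)ˣ) : ZMod f)) →
        Nat.card {y : ↥(classGroupChiComponent ℚ L p (fun g => ((χ g : ℤ_[p]ˣ) : ℤ_[p]))) // p • y = 0} ≤ p)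
    {v : HeightOneSpectrum (𝓞 ℚ)} (hpv : ((p : ℕ) : 𝓞 ℚ) ∈ v.asIdeal)
    (hE : ∀ (Φ : StableSubgroup (absoluteGaloisGroup ℚ) (geomTorsion W (p : ℤ))), Nat.card Φ.Sub = p →
      ∀ c : absoluteGaloisGroup ℚ, IsComplexConjugation (Rat.castHom ℝ) c →
        ((∀ x : Φ.Sub, c • x = x) →
          Nat.card ↥(h1Unramified Φ.Sub (∅ : Set (HeightOneSpectrum (𝓞 ℚ)))) ≤ 1) ∧
        ((∀ x : Φ.Sub, c • x = -x) →
          Nat.card ↥(h1Unramified Φ.Quot (∅ : Set (HeightOneSpectrum (𝓞 ℚ)))) ≤ 1)) :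
    ∀ x : W.sha, (p : ℤ) • x = 0 → x = 0 :=
  ParitySplit.noPTorsion_of_natCard_selmerGroup_le_sq W p hCT hGZK hr
    (natCard_selmerGroup_le_sq_of_evenRegular_of_chiTorsion_le W hCM hram h5 ψ ω hψ hω hss hrank hpv hE)

/-- **On «EVEN-REGULAR ∧ cyclic `ψ`-components», `BSD(W,p) ⟺ p ∤ #Ш_an(W)`** (mod Cassels–Tate, GZK; `r_an = 1`) — no Bernoulli number,
no Mazur–Wiles (`#Sel_p ≤ p²` + w3 g8's `ParitySplit.bsdp_iff_shaAn_unit_of_natCard_selmerGroup_le_sq`). [cite: Cassels1962ArithmeticIV]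
[cite: Miller2011LMS, Def. 1.1] -/
theorem bsdp_iff_shaAnUnit_of_evenRegular_of_chiTorsion_le
    (hCT : exists_casselsTate_pairing (K := ℚ)) (hGZK : rank_eq_analyticRank_of_analyticRank_le_one)
    (hCM : W.HasCM) (hram : CMRamified W p) (h5 : 5 ≤ p) (hr : W.analyticRank = 1)
    {f : ℕ} [NeZero f] (ψ : DirichletCharacter ℚ_[p] f) (ω : DirichletCharacter ℚ_[p] p)
    (hψ : ψ.Odd) (hω : IsTeichmullerCharacter ω)
    (hss : ∀ ℓ : ℕ, ℓ.Prime → ¬ (ℓ ∣ p * W.conductorNorm ℤ) →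
      ‖((W.LFunction ℓ : ℤ) : ℚ_[p]) - (ψ (ℓ : ZMod f) + ψ⁻¹ (ℓ : ZMod f) * ω (ℓ : ZMod p))‖ < 1)
    (hrank : ∀ (L : Type) [Field L] [NumberField L] [IsAbelianGalois ℚ L], ¬ p ∣ Module.finrank ℚ L →
      ∀ χ : (L ≃ₐ[ℚ] L) →* ℤ_[p]ˣ,
        (∀ τ : absoluteGaloisGroup ℚ, (((χ (absGaloisQuot ℚ L τ) : ℤ_[p]ˣ) : ℤ_[p]) : ℚ_[p]) =
          ψ ((modNCyclotomicCharacter ℚ f τ : (ZMod f)ˣ) : ZMod f)) →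
        Nat.card {y : ↥(classGroupChiComponent ℚ L p (fun g => ((χ g : ℤ_[p]ˣ) : ℤ_[p]))) // p • y = 0} ≤ p)
    {v : HeightOneSpectrum (𝓞 ℚ)} (hpv : ((p : ℕ) : 𝓞 ℚ) ∈ v.asIdeal)
    (hE : ∀ (Φ : StableSubgroup (absoluteGaloisGroup ℚ) (geomTorsion W (p : ℤ))), Nat.card Φ.Sub = p →
      ∀ c : absoluteGaloisGroup ℚ, IsComplexConjugation (Rat.castHom ℝ) c →
        ((∀ x : Φ.Sub, c • x = x) →
          Nat.card ↥(h1Unramified Φ.Sub (∅ : Set (HeightOneSpectrum (𝓞 ℚ)))) ≤ 1) ∧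
        ((∀ x : Φ.Sub, c • x = -x) →
          Nat.card ↥(h1Unramified Φ.Quot (∅ : Set (HeightOneSpectrum (𝓞 ℚ)))) ≤ 1)) :
    BSDp W p ↔ ∃ q : ℚ, shaAn W = (q : ℂ) ∧ padicValRat p q = 0 :=
  ParitySplit.bsdp_iff_shaAn_unit_of_natCard_selmerGroup_le_sq W p hCT hGZK hr
    (natCard_selmerGroup_le_sq_of_evenRegular_of_chiTorsion_le W hCM hram h5 ψ ω hψ hω hss hrank hpv hE)

end Summit.BirchSwinnertonDyer.BirchSwinnertonDyer.Theorems.PrintCFram.SelmerCount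

end
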